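import Summits.BirchSwinnertonDyer.BirchSwinnertonDyer.Theorems.ManinLocalTwoThreeShimuraQuotientFourP
import Summits.BirchSwinnertonDyer.BirchSwinnertonDyer.Theorems.ManinLocalTwoThreeHalfLatticeVelu
import Summits.BirchSwinnertonDyer.Rank1Residual.ManinAdditive.ShimuraLedger
import Literature.NumberTheory.EllipticCurves.LatticeIndexTwoHalfPeriodProofs
import HarnessLib

/-!
# A non-homothetic Shimura cover produces a RATIONAL `2`-torsion point; so at `N = 4p` an optimal curve with
# `E₀(ℚ)[2] = 0` IS Stevens' curve: `Λ₁(f) = Λ₀(f)` and `|c₀| = |c₁|`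

Summit `BirchSwinnertonDyer`, route `ManinLocalTwoThree` (cell bsd-f2-manin), deciding crux C2 `ManinOddAtFour`
(stmt-BirchSwinnertonDyer-22967).  Complement to the blind-residual file `…BlindNoDoubling` (p634444) on the IRREDUCIBLE side
(no rational `2`-torsion ⟺ `W[2]` irreducible, the Kato road's locus): for the optimal `X₁(N)`/`X₀(N)` pair `(D₁, D₀)` of a
class at `4 ∣ N` (`W₀ = [0, a₂, 0, a₄, a₆]`), the four lattices `Λ_{E₀} = c₀Λ₀(f)`, `Λ_{E₁} = c₁Λ₁(f)` with `c₁ ∣ c₀ ∣ 2c₁`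
and `2Λ₀ ⊆ Λ₁ ⊆ Λ₀` sit in a chain of index-`≤ 4` inclusions; the half-lattice trichotomy (p633660) and the rationality of an
index-`2` half-period (`PeriodPair.exists_ratCast_eq_weierstrassP_of_index_two`, p632972; a lattice with rational invariants
rescaled by `½` again has rational invariants) give:

* `trichotomy_shimura_of_four_dvd_level` — `Λ₁(f) = Λ₀(f)` (index `1`), or `Λ₁(f) = 2Λ₀(f)` (index `4`), or `W₀` HAS A
  RATIONAL `2`-TORSION POINT (index `2`: the kernel of the degree-`2` Shimura cover, or of its dual, is rational).
* `stevens_eq_optimal_of_noRationalTwoTorsion_four_mul[_prime]` — at `N = 4q` (`q` odd, `(ℤ/q)ˣ` cyclic; `N = 4p`), where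
  index `4` is impossible (p632017): **`E₀(ℚ)[2] = 0 ⟹ Λ₁(f) = Λ₀(f)` and `|c₀| = |c₁|`** — Stevens' `X₁(N)`-optimal curve is the
  `X₀(N)`-optimal curve and the two Manin constants agree up to sign (on paper: `E₀ ∩ Σ(N)` is a rational `μ`-type group
  killed by `2`, Ling–Oesterlé / Vatsal 2005 Rem. 1.8; here from lattices alone).

HONEST FRAMING: structure only; C2, Manin's conjecture and BSD are not proved.  No definitions.
-/

set_option autoImplicit false
-- the summit-side namespace `Summit.BirchSwinnertonDyer.BirchSwinnertonDyer.…` is the tree's (summit = sub-problem)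
set_option linter.dupNamespace false

noncomputable section

open WeierstrassCurve Literature.NumberTheory.EllipticCurves Literature.NumberTheory.EllipticCurves.ModularForms
open CongruenceSubgroup
open Summit.BirchSwinnertonDyer.Rank1Residual.ManinAdditive.ShimuraLedger

namespace Summit.BirchSwinnertonDyer.BirchSwinnertonDyer.Theorems.ManinLocalTwoThree

variable {W₁ W₀ : WeierstrassCurve ℚ} [W₁.IsElliptic] [W₁.IsGloballyMinimal] [W₀.IsElliptic]
  [W₀.IsGloballyMinimal] {N : ℕ} [NeZero N]

omit [W₀.IsElliptic] [W₀.IsGloballyMinimal] in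
/-- **An index-`2` superlattice with rational invariants yields a rational `2`-torsion point.**  `W₀ = [0, a₂, 0, a₄, a₆]`
with Néron-type pair `L₀`; `L'` a period pair with rational `g₂, g₃`, `Λ₀ ⊆ Λ'` of index `2` generated by `z₀` with
`2z₀ ∈ Λ₀`: then `x³ + a₂x² + a₄x + a₆` has the rational root `℘_{Λ₀}(z₀) − a₂/3`. -/
theorem hasRationalTwoTorsion_of_index_two (ha₁ : W₀.a₁ = 0) (ha₃ : W₀.a₃ = 0) {L₀ : PeriodPair}
    (hL₀ : IsNeronLatticeOf (W₀.baseChange ℂ) L₀) (L' : PeriodPair)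
    (h₂' : ∃ r : ℚ, (r : ℂ) = L'.g₂) (h₃' : ∃ r : ℚ, (r : ℂ) = L'.g₃) (hle : L₀.lattice ≤ L'.lattice)
    {z₀ : ℂ} (hz₀' : z₀ ∈ L'.lattice) (hz₀ : z₀ ∉ L₀.lattice) (h2 : 2 * z₀ ∈ L₀.lattice)
    (hidx : ∀ w ∈ L'.lattice, w ∈ L₀.lattice ∨ w - z₀ ∈ L₀.lattice) : HasRationalTwoTorsion W₀ := by
  have hc₄ : (W₀.baseChange ℂ).c₄ = (W₀.c₄ : ℂ) := by simp [WeierstrassCurve.baseChange, WeierstrassCurve.map_c₄]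
  have hc₆ : (W₀.baseChange ℂ).c₆ = (W₀.c₆ : ℂ) := by simp [WeierstrassCurve.baseChange, WeierstrassCurve.map_c₆]
  obtain ⟨x, hx⟩ := L₀.exists_ratCast_eq_weierstrassP_of_index_two L' hle
    ⟨W₀.c₄ / 12, by rw [hL₀.1, hc₄]; push_cast; ring⟩ ⟨W₀.c₆ / 216, by rw [hL₀.2, hc₆]; push_cast; ring⟩
    h₂' h₃' hz₀' hz₀ hidx
  have hcubic : 4 * (L₀).weierstrassP z₀ ^ 3 - L₀.g₂ * (L₀).weierstrassP z₀ - L₀.g₃ = 0 := by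
    rw [← L₀.derivWeierstrassP_sq z₀ hz₀, L₀.derivWeierstrassP_eq_zero_of_two_mul_mem h2]; ring
  have heC := isRoot_cubic_of_weierstrassP_sub W₀ ha₁ ha₃ hL₀ hcubic
  rw [← hx] at heC
  refine ⟨x - W₀.a₂ / 3, ?_⟩
  have h : (((x - W₀.a₂ / 3) ^ 3 + W₀.a₂ * (x - W₀.a₂ / 3) ^ 2 + W₀.a₄ * (x - W₀.a₂ / 3) + W₀.a₆ : ℚ) : ℂ) = 0 := by
    push_cast; exact heC
  exact_mod_cast h

/-- **Shimura trichotomy for the optimal pair at `4 ∣ N`.**  For the optimal `X₁(N)`-datum `D₁` and the optimal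
`X₀(N)`-datum `D₀` of a class (globally minimal, `W₀ = [0, a₂, 0, a₄, a₆]`): `Λ₁(f) = Λ₀(f)`, or `Λ₁(f) = 2Λ₀(f)`, or
`W₀` has a rational `2`-torsion point.  (Undoubled `|c₀| = |c₁|`: trichotomy on `Λ_{E₀} ⊆ ½Λ_{E₁}`; doubled
`|c₀| = 2|c₁|`: on `Λ_{E₀} ⊆ Λ_{E₁}`; the index-`2` cases give a rational half-period abscissa.) -/
theorem trichotomy_shimura_of_four_dvd_level (D₁ : Gamma1ParametrizationData W₁ N)
    (D₀ : ModularParametrizationData W₀ N) (hiso : IsIsogenous W₁ W₀) (h₁ : D₁.IsOptimal)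
    (h₀ : ∀ z ∈ D₀.L.lattice, ∃ w ∈ periodLattice D₀.f, z = D₀.c * w) (h4 : 2 ^ 2 ∣ N)
    (ha₁ : W₀.a₁ = 0) (ha₃ : W₀.a₃ = 0) :
    periodLatticeGamma1 D₀.f = periodLattice D₀.f ∨
      (∀ z : ℂ, z ∈ periodLatticeGamma1 D₀.f ↔ ∃ w ∈ periodLattice D₀.f, z = 2 * w) ∨
      HasRationalTwoTorsion W₀ := by
  have hf : D₁.f = D₀.f := D₁.f_eq_of_isIsogenous D₀ hiso
  have hc₁ : (D₁.c : ℂ) ≠ 0 := by exact_mod_cast D₁.maninConstant_ne_zero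
  have hc₀ : (D₀.c : ℂ) ≠ 0 := by exact_mod_cast D₀.maninConstant_ne_zero_holds
  have hc₄W₁ : (W₁.baseChange ℂ).c₄ = (W₁.c₄ : ℂ) := by simp [WeierstrassCurve.baseChange, WeierstrassCurve.map_c₄]
  have hc₆W₁ : (W₁.baseChange ℂ).c₆ = (W₁.c₆ : ℂ) := by simp [WeierstrassCurve.baseChange, WeierstrassCurve.map_c₆]
  have hg₂₁ : ∃ r : ℚ, (r : ℂ) = D₁.L.g₂ := ⟨W₁.c₄ / 12, by rw [D₁.isNeronLattice.1, hc₄W₁]; push_cast; ring⟩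
  have hg₃₁ : ∃ r : ℚ, (r : ℂ) = D₁.L.g₃ := ⟨W₁.c₆ / 216, by rw [D₁.isNeronLattice.2, hc₆W₁]; push_cast; ring⟩
  -- Ling–Oesterlé at `2`
  have h2Λ : ∀ w ∈ periodLattice D₀.f, (2 : ℂ) * w ∈ periodLatticeGamma1 D₀.f := fun w hw ↦ by
    have h := pMulLatticeLeGamma1OfTracelessPrime_holds N D₀.f D₀.isNewformOf.1 2 Nat.prime_two
      ((dvd_pow_self 2 two_ne_zero).trans h4) (D₀.isNewformOf.1.cuspCoeff_eq_zero_of_sq_dvd Nat.prime_two h4) w hw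
    exact_mod_cast h
  -- the index-1 and index-4 outputs, from lattice data
  have out1 : (∀ w ∈ periodLattice D₀.f, w ∈ periodLatticeGamma1 D₀.f) →
      periodLatticeGamma1 D₀.f = periodLattice D₀.f :=
    fun h ↦ le_antisymm (periodLatticeGamma1_le_periodLattice D₀.f) h
  have out4 : (∀ z ∈ periodLatticeGamma1 D₀.f, ∃ w ∈ periodLattice D₀.f, z = 2 * w) →
      ∀ z : ℂ, z ∈ periodLatticeGamma1 D₀.f ↔ ∃ w ∈ periodLattice D₀.f, z = 2 * w :=
    fun h z ↦ ⟨h z, by rintro ⟨w, hw, rfl⟩; exact h2Λ w hw⟩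
  -- the ledger: `c₀ = ε c₁` or `c₀ = ε · 2c₁`
  rcases natAbs_maninConstant₀_eq_or_eq_two_mul_of_four_dvd_level D₁ D₀ hiso h₁ h₀ h4 with habs | habs
  · -- undoubled: `Λ_{E₁} ⊆ Λ_{E₀} ⊆ ½Λ_{E₁}`; trichotomy on `(Λ_{E₀}, ½Λ_{E₁})`
    obtain ⟨ε, hε, hcc⟩ : ∃ ε : ℂ, (ε = 1 ∨ ε = -1) ∧ (D₀.c : ℂ) = ε * D₁.c := by
      rcases Int.natAbs_eq_natAbs_iff.mp habs with h' | h'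
      · exact ⟨1, Or.inl rfl, by rw [one_mul]; exact_mod_cast h'⟩
      · exact ⟨-1, Or.inr rfl, by rw [neg_one_mul]; exact_mod_cast h'⟩
    have hε2 : ε * ε = 1 := by rcases hε with rfl | rfl <;> norm_num
    have hεmem : ∀ (S : AddSubgroup ℂ) (w : ℂ), w ∈ S → ε * w ∈ S := by
      intro S w hw; rcases hε with rfl | rfl
      · rwa [one_mul]
      · rw [neg_one_mul]; exact neg_mem hw
    set H : PeriodPair := D₁.L.mulLeft ((2 : ℂ)⁻¹) (inv_ne_zero two_ne_zero) with hH
    have hHmem : ∀ z, z ∈ H.lattice ↔ 2 * z ∈ D₁.L.lattice := fun z ↦ by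
      rw [hH, PeriodPair.mem_mulLeft_lattice, inv_inv]
    have hle : D₀.L.lattice ≤ H.lattice := by
      intro z hz
      obtain ⟨w, hw, rfl⟩ := h₀ z hz
      rw [hHmem]
      have e : 2 * ((D₀.c : ℂ) * w) = (D₁.c : ℂ) * (ε * (2 * w)) := by rw [hcc]; ring
      rw [e]
      exact D₁.smul_periodLatticeGamma1_le _ (hεmem _ _ (by rw [hf]; exact h2Λ w hw))
    have htwo : ∀ w ∈ H.lattice, 2 * w ∈ D₀.L.lattice := by
      intro w hw
      rw [hHmem] at hw
      obtain ⟨w₁, hw₁, hw₁'⟩ := h₁ _ hw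
      have hw₀ : ε * w₁ ∈ periodLattice D₀.f := hεmem _ _ (hf ▸ periodLatticeGamma1_le_periodLattice D₁.f hw₁)
      have e : 2 * w = (D₀.c : ℂ) * (ε * w₁) := by
        rw [hw₁', hcc]; linear_combination -((D₁.c : ℂ) * w₁) * hε2
      rw [e]; exact D₀.smul_periodLattice_le _ hw₀
    rcases halfLattice_trichotomy D₀.L H hle htwo with hcase | hcase | hcase
    · -- `½Λ_{E₁} ⊆ Λ_{E₀}`: `Λ₁ ⊆ 2Λ₀`, index 4
      right; left
      refine out4 fun z hz ↦ ?_
      have hzH : (D₁.c : ℂ) * z * 2⁻¹ ∈ H.lattice := by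
        rw [hHmem, show 2 * ((D₁.c : ℂ) * z * 2⁻¹) = (D₁.c : ℂ) * z by ring]
        exact D₁.smul_periodLatticeGamma1_le z (hf ▸ hz)
      obtain ⟨w, hw, hw'⟩ := h₀ _ (hcase _ hzH)
      refine ⟨ε * w, hεmem _ _ hw, ?_⟩
      have h : (D₁.c : ℂ) * z = (D₁.c : ℂ) * (2 * (ε * w)) := by
        rw [show (D₁.c : ℂ) * z = 2 * ((D₁.c : ℂ) * z * 2⁻¹) by ring, hw', hcc]; ring
      exact mul_left_cancel₀ hc₁ h
    · -- `½Λ_{E₀} ⊆ ½Λ_{E₁}`: `Λ₀ ⊆ Λ₁`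
      left
      refine out1 fun w hw ↦ ?_
      have h2h : 2 * ((D₀.c : ℂ) * w * 2⁻¹) ∈ D₀.L.lattice := by
        rw [show 2 * ((D₀.c : ℂ) * w * 2⁻¹) = (D₀.c : ℂ) * w by ring]; exact D₀.smul_periodLattice_le w hw
      have hH' := hcase _ h2h
      rw [hHmem, show 2 * ((D₀.c : ℂ) * w * 2⁻¹) = (D₀.c : ℂ) * w by ring] at hH'
      obtain ⟨w₁, hw₁, hw₁'⟩ := h₁ _ hH'
      have hw' : w = ε * w₁ := by
        have h : (D₁.c : ℂ) * w = (D₁.c : ℂ) * (ε * w₁) := by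
          rw [hcc] at hw₁'
          linear_combination ε * hw₁' - ((D₁.c : ℂ) * w) * hε2
        exact mul_left_cancel₀ hc₁ h
      rw [hw', ← hf]; exact hεmem _ _ hw₁
    · -- index 2: rational half-period of `Λ_{E₀}`
      right; right
      obtain ⟨z₀, hz₀', hz₀, hidx⟩ := hcase
      refine hasRationalTwoTorsion_of_index_two ha₁ ha₃ D₀.isNeronLattice H ?_ ?_ hle hz₀' hz₀ (htwo z₀ hz₀') hidx
      · obtain ⟨r, hr⟩ := hg₂₁
        exact ⟨2 ^ 4 * r, by rw [hH, PeriodPair.g₂_mulLeft, ← hr]; push_cast; ring⟩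
      · obtain ⟨r, hr⟩ := hg₃₁
        exact ⟨2 ^ 6 * r, by rw [hH, PeriodPair.g₃_mulLeft, ← hr]; push_cast; ring⟩
  · -- doubled: `Λ_{E₀} ⊆ Λ_{E₁} ⊆ ½Λ_{E₀}`; trichotomy on `(Λ_{E₀}, Λ_{E₁})`
    obtain ⟨ε, hε, hcc⟩ : ∃ ε : ℂ, (ε = 1 ∨ ε = -1) ∧ (D₀.c : ℂ) = ε * (2 * D₁.c) := by
      have h : D₀.maninConstant.natAbs = (2 * D₁.maninConstant).natAbs := by rw [habs, Int.natAbs_mul]; rfl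
      rcases Int.natAbs_eq_natAbs_iff.mp h with h' | h'
      · exact ⟨1, Or.inl rfl, by rw [one_mul]; exact_mod_cast h'⟩
      · exact ⟨-1, Or.inr rfl, by rw [neg_one_mul]; exact_mod_cast h'⟩
    have hε2 : ε * ε = 1 := by rcases hε with rfl | rfl <;> norm_num
    have hεmem : ∀ (S : AddSubgroup ℂ) (w : ℂ), w ∈ S → ε * w ∈ S := by
      intro S w hw; rcases hε with rfl | rfl
      · rwa [one_mul]
      · rw [neg_one_mul]; exact neg_mem hw
    have hle : D₀.L.lattice ≤ D₁.L.lattice := by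
      intro z hz
      obtain ⟨w, hw, rfl⟩ := h₀ z hz
      have e : (D₀.c : ℂ) * w = (D₁.c : ℂ) * (ε * (2 * w)) := by rw [hcc]; ring
      rw [e]
      exact D₁.smul_periodLatticeGamma1_le _ (hεmem _ _ (by rw [hf]; exact h2Λ w hw))
    have htwo : ∀ w ∈ D₁.L.lattice, 2 * w ∈ D₀.L.lattice := by
      intro w hw
      obtain ⟨w₁, hw₁, rfl⟩ := h₁ w hw
      have hw₀ : ε * w₁ ∈ periodLattice D₀.f := hεmem _ _ (hf ▸ periodLatticeGamma1_le_periodLattice D₁.f hw₁)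
      have e : 2 * ((D₁.c : ℂ) * w₁) = (D₀.c : ℂ) * (ε * w₁) := by
        rw [hcc]; linear_combination -(2 * (D₁.c : ℂ) * w₁) * hε2
      rw [e]; exact D₀.smul_periodLattice_le _ hw₀
    rcases halfLattice_trichotomy D₀.L D₁.L hle htwo with hcase | hcase | hcase
    · -- `Λ_{E₁} = Λ_{E₀}`: index 4
      right; left
      refine out4 fun z hz ↦ ?_
      have hz' : (D₁.c : ℂ) * z ∈ D₀.L.lattice := hcase _ (D₁.smul_periodLatticeGamma1_le z (hf ▸ hz))
      obtain ⟨w, hw, hw'⟩ := h₀ _ hz'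
      refine ⟨ε * w, hεmem _ _ hw, ?_⟩
      have h : (D₁.c : ℂ) * z = (D₁.c : ℂ) * (2 * (ε * w)) := by rw [hw', hcc]; ring
      exact mul_left_cancel₀ hc₁ h
    · -- `Λ_{E₁} ⊇ ½Λ_{E₀}`: `Λ₁ = Λ₀`
      left
      refine out1 fun w hw ↦ ?_
      have h2h : 2 * (ε * ((D₁.c : ℂ) * w)) ∈ D₀.L.lattice := by
        have e : 2 * (ε * ((D₁.c : ℂ) * w)) = (D₀.c : ℂ) * w := by rw [hcc]; ring
        rw [e]; exact D₀.smul_periodLattice_le w hw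
      obtain ⟨w₁, hw₁, hw₁'⟩ := h₁ _ (hcase _ h2h)
      have hw' : w = ε * w₁ := by
        have h : (D₁.c : ℂ) * w = (D₁.c : ℂ) * (ε * w₁) := by
          linear_combination ε * hw₁' - ((D₁.c : ℂ) * w) * hε2
        exact mul_left_cancel₀ hc₁ h
      rw [hw', ← hf]; exact hεmem _ _ hw₁
    · -- index 2: rational half-period of `Λ_{E₀}`
      right; right
      obtain ⟨z₀, hz₀', hz₀, hidx⟩ := hcase
      exact hasRationalTwoTorsion_of_index_two ha₁ ha₃ D₀.isNeronLattice D₁.L hg₂₁ hg₃₁ hle hz₀' hz₀ (htwo z₀ hz₀') hidx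

/-- **At `N = 4q` (`q` odd, `(ℤ/q)ˣ` cyclic): an optimal curve with NO rational `2`-torsion is Stevens' curve** —
`Λ₁(f) = Λ₀(f)` and `|c₀| = |c₁|` (index `4` is impossible at these levels, `not_periodLatticeGamma1_eq_two_mul_of_four_mul`;
index `1` gives `|c₀| = |c₁|`, `natAbs_maninConstant₀_eq_of_periodLatticeGamma1_eq_periodLattice`). -/
theorem stevens_eq_optimal_of_noRationalTwoTorsion_four_mul {q : ℕ} (hq : Odd q) [IsCyclic (ZMod q)ˣ] [NeZero (4 * q)]
    (D₁ : Gamma1ParametrizationData W₁ (4 * q)) (D₀ : ModularParametrizationData W₀ (4 * q))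
    (hiso : IsIsogenous W₁ W₀) (h₁ : D₁.IsOptimal)
    (h₀ : ∀ z ∈ D₀.L.lattice, ∃ w ∈ periodLattice D₀.f, z = D₀.c * w)
    (ha₁ : W₀.a₁ = 0) (ha₃ : W₀.a₃ = 0) (hno : ¬ HasRationalTwoTorsion W₀) :
    periodLatticeGamma1 D₀.f = periodLattice D₀.f ∧ D₀.maninConstant.natAbs = D₁.maninConstant.natAbs := by
  have hf : D₁.f = D₀.f := D₁.f_eq_of_isIsogenous D₀ hiso
  rcases trichotomy_shimura_of_four_dvd_level D₁ D₀ hiso h₁ h₀ ⟨q, rfl⟩ ha₁ ha₃ with h | h | h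
  · exact ⟨h, natAbs_maninConstant₀_eq_of_periodLatticeGamma1_eq_periodLattice D₁ D₀ h₁ h₀ hf h⟩
  · exact absurd h (not_periodLatticeGamma1_eq_two_mul_of_four_mul hq D₀ h₀)
  · exact absurd h hno

/-- **At `N = 4p`, `p` an odd prime**: no rational `2`-torsion ⟹ `Λ₁(f) = Λ₀(f)` and `|c₀| = |c₁|`. -/
theorem stevens_eq_optimal_of_noRationalTwoTorsion_four_mul_prime {p : ℕ} (hp : p.Prime) (hp2 : p ≠ 2)
    [NeZero (4 * p)] (D₁ : Gamma1ParametrizationData W₁ (4 * p)) (D₀ : ModularParametrizationData W₀ (4 * p))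
    (hiso : IsIsogenous W₁ W₀) (h₁ : D₁.IsOptimal)
    (h₀ : ∀ z ∈ D₀.L.lattice, ∃ w ∈ periodLattice D₀.f, z = D₀.c * w)
    (ha₁ : W₀.a₁ = 0) (ha₃ : W₀.a₃ = 0) (hno : ¬ HasRationalTwoTorsion W₀) :
    periodLatticeGamma1 D₀.f = periodLattice D₀.f ∧ D₀.maninConstant.natAbs = D₁.maninConstant.natAbs := by
  haveI : IsCyclic (ZMod p)ˣ := ZMod.isCyclic_units_prime hp
  exact stevens_eq_optimal_of_noRationalTwoTorsion_four_mul (hp.odd_of_ne_two hp2) D₁ D₀ hiso h₁ h₀ ha₁ ha₃ hno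

end Summit.BirchSwinnertonDyer.BirchSwinnertonDyer.Theorems.ManinLocalTwoThree

end
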